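import Mathlib
import Literature.MathematicalPhysics.QuantumFieldTheory.Balaban1983to89.B9SectDWeightedNeumann
import Literature.MathematicalPhysics.QuantumFieldTheory.Balaban1983to89.T4EtaRate
import Literature.MathematicalPhysics.QuantumFieldTheory.Balaban1983to89.B9Thm34Ext
import Literature.MathematicalPhysics.QuantumFieldTheory.Balaban1983to89.B11KernelDictionary

/-!
# `Balaban1983to89.T4EtaRateDefect` — kernel bookkeeping for T4-DAG node U1a (`t4/T4-EST-U1a.md` §3 STEP 0 = NE2-WALK,
STEP 3 = NE2-ALG): THE η-RATE OF A NEUMANN / RANDOM-WALK EXPANSION IS INHERITED FROM THE η-RATES OF ITS SOURCE AND OF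
ITS STEP, WITH ONE LOCATED RATE LOSS.  The INTERTWINING DEFECT `𝔇(A′,A) = A′τ₁ − τ₂A` of two runs' fixed points
`A = S + KA` (coarse run) and `A′ = S′ + K′A′` (fine run) through transports `τ₁` (inputs), `τ₂` (outputs) solves the
fine run's equation again, `𝔇_A = (𝔇_S + 𝔇_K·A) + K′·𝔇_A` (`idef_fix`), hence inherits the decay class of
`B11SectG.HasMaj` block majorants from the PRIMITIVE defects `𝔇_S = 𝔇(S′,S)`, `𝔇_K = K′τ₂ − τ₂K` through the kernel
Neumann lemma `B9SectDWeightedNeumann.neumann_majorant_wrow` — the loss being the tilt `σ` of the site weight the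
defects carry (for the η-rate weight `(L^j)^{−γ}` of a source site in `Λ_j`: `σ = γ·ln L/(RM)`, constant `L^γ`, by [B6]
(2.60)).  (Cell `pub-balaban`, unit `b2b-balaban-pv25-g13` = the η-rate lineage of `T4EtaRate` / `T4EtaRateMin` /
`T4RateAlgebra` / `T4RateLiaison` / `T4SupCloseLiaison`; self-proposed row T4-U1a.S-NE2-DEFECT-CALCULUS° under the yield
clause of T4-DAG v19 §8 Q24(a); imports `B9SectDWeightedNeumann`, `T4EtaRate`, `B9Thm34Ext`, `B11KernelDictionary` BY
NAME, nothing in the tree modified; NO NEW ESTIMATE about the audited construction, NOT summit progress.)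

HONEST FRAMING (cell `pub-balaban`, T4-DAG PAGE 1).  The cell's T4 target is rung (B)+1: existence AND uniqueness of the
continuum limit of Bałaban's unit-scale averaged loop expectations on a FIXED finite torus — strictly beyond ultraviolet
stability ([Balaban1988Convergent] Cor. 3 p. 264; [Balaban1989LargeFieldII] Thm 1 p. 355); NOT infinite volume, NOT a
mass gap, NOT the Clay problem.  NOTHING comparing two lattice spacings is printed in [B6]/[B9]: the manuscripts construct
ONE run.  Node U1a (= NE2⁺, the η-rate of the background propagators, `T4EtaRate.NE2PlusOperator/Site/Unit`) is recorded
in the cell as a NEW ESTIMATE assembled from printed MECHANISMS (`t4/T4-EST-U1a.md` §4 verdict; cell GAPS G-t4-U1a-4,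
G-ne2p2-4, G-ne2p2-4a: for U ≠ 1 there is no momentum representation, so the direct technique of the U = 1 layer
(`T4Cov2156Rate`, `T4Rate166StripDirect`, `T4Hk163StripRate`) does not apply).  The printed mechanism this module
abstracts is the one [B9] uses for DOMAIN differences, Thm 3.14 pp. 426–427 (verbatim, tree `B9.Thm314Printed`): *"If we
take a pair of operators constructed for the two sequences {Ω_j}, {Ω′_j}, then their difference satisfies all the
inequalities characteristic for operators of the considered type, with the additional factor exp(−δ₀d(y, y′, Ω)) … on the
right-hand sides"*, proved there by the sketch p. 427 (verbatim, tree `B9.lean` Phase 2b): *"We take random walk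
expansions for both operators, and in the difference all terms for walks with localizations contained in Ω are
cancelled."*  Here «two sequences of domains» ↦ «two runs related by transports», «additional factor» ↦ «source weight
`w(y′)`» (the η-rate weight = the site-dependent part of `T4EtaRate.rateFactor`, King's factor `L^{−γk}` of
[King1986] Prop. 3.9 (3.73) p. 665 rewritten covariantly, `T4EtaRate` header (3)), and «cancelled» ↦ «expanded by the
Leibniz rule into primitive defects» — at the level of BLOCK MAJORANTS ONLY (operators, block norms, transports,
majorants are data; every estimate a binder).

WHAT THIS MODULE IS (all declarations [folklore] = linear algebra and real arithmetic over hypothesis-shaped data, or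
cite a printed display for its SHAPE only):
* §1 `idef τ₁ τ₂ T′ T = T′ ∘ τ₁ − τ₂ ∘ T` (LinearMap level; matrix-level sibling of the r1 lineage: `B9SectCDiff.tdef`,
  `tdef_mul`, `tdef_inv`) with `idef_comp` (LEIBNIZ: `𝔇(T₁′T₂′,T₁T₂) = T₁′𝔇(T₂′,T₂) + 𝔇(T₁′,T₁)T₂` — fine factors left,
  coarse factors right), `idef_add/sub/smul/zero`, `idef_fix` (THE FIXED-POINT IDENTITY above) and `idef_inv` (exact:
  `𝔇(G′,G) = −G′𝔇(Δ′,Δ)G` for a left inverse `G′` of `Δ′` and a right inverse `G` of `Δ` — rate = stability × consistency;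
  matrix sibling `T4TwoSpacingDefect.inv_sub_inv_eq_twoSpacing`).
* §2 SOURCE WEIGHTS.  `wnorm b w` = the block norm `b` reweighted by `w ≥ 0` at the site (`loc_w y f = w(y)·loc y f`);
  `hasMaj_wnorm_iff`: a source-weighted majorant `K(y,y′)·w(y′)` from `b₁` IS the majorant `K` from `wnorm b₁ w` — so
  `B11SectG` / `B9SectDWeightedNeumann` apply to source-weighted majorants verbatim (`hasMaj_comp_wrow_source`);
  `SlowWeight g σ C w` (`w(y) ≤ C·w(y′)·e^{σd(y,y′)}`, matrix sibling `B9SectCDiffEstimate.Transfer`); THE ONE LOCATED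
  LOSS `hasMaj_comp_transfer`: a weight sitting at an INTERMEDIATE site of a composition moves to the source at the cost
  of its tilt `σ` out of the right factor's rate and its constant `C` (then `conv_wrow_exp`, triangle inequality (2.54)
  only); adapters `HasMaj.max_of_source` (source form ⇒ the `max` form of `T4EtaRate.EtaRateIneq342`, free) and
  `HasMaj.source_of_max` (converse, one tilt); `hasMaj_apriori_weighted` (a priori bounds under a positive weight).
* §3 THE ESTIMATES.  `idef_neumann_majorant` (MAIN): coarse fixed point with majorant `A∞e^{−(ρ+σ)d}`, fine step `K′`
  with `‖N′‖_ρ ≤ m′`, `q′ = κ₂′m′ < 1`, primitive defects `𝔇_S ≤ ε_S e^{−ρd}w(y′)`, `𝔇_K ≤ N_K(y,y″)w(y″)` with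
  `‖N_K‖_ρ ≤ m_K`, slow weight (σ, C), a priori bound ⟹ `𝔇_A ≤ (ε_S + κ₂m_KA∞C)(1 − q′)⁻¹e^{−ρd(y,y′)}w(y′)`;
  `idef_neumann_majorant_flat` (`w ≡ 1`: no loss — the unit-layer / `θ^k`-as-a-constant case);
  `idef_neumann_majorant_of_primitives` (the coarse majorant itself from `neumann_majorant_wrow` at rate `ρ + σ`:
  `A∞ = A_S(1 − q)⁻¹`); `idef_comp_majorant` (Leibniz + one loss); `idef_inv_majorant` (inverses: `κ₁′m_G·κ₂m_Δ·a·C`).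
* §4 THE η-RATE WEIGHT `rateWeight g γ y = (L^j)^{−γ}` (`= T4EtaRate.rateFactor` on the [B6]-view of a [B9] geometry,
  `rateWeight_toB6`; `rateWeight_pos`, `rateWeight_eq_exp`) IS SLOW with tilt `γ·ln L/(RM)` and constant `L^γ` under the
  level gap of [B6] Lemma 2.1 (2.60) p. 234 (verbatim, tree `B6.lean`): *"e^{−αδ₀d(y,y′)} ≤ e^{−αδ₀RM max{|j−j′|−1,0}},
  y ∈ Λ_j, y′ ∈ Λ_{j′}"* (`B6RandomWalk.Ineq260` ⟹ `B11KernelDictionary.LevelGap` by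
  `B11KernelDictionary.levelGap_of_ineq260`, both by name): `slowWeight_rateWeight`, `slowWeight_rateWeight_of_ineq260`
  (real-exponent form of `B9SectDL2Decay.pow_scale_le_of_ineq260` / `B11KernelDictionary.len_le_exchange`); and the
  η-RATE FORM of the main estimate, `idef_neumann_majorant_rateWeight` (constant `(ε_S + κ₂m_KA∞L^γ)(1 − κ₂′m′)⁻¹`).
* §5 NON-VACUITY WITH THE RIGHT CONSTANT: on the one-site geometry `toyG` with the block norm `|·|` on `ℝ` (`toyB`),
  `idef_neumann_majorant_flat` returns for scalar runs `a = s + ka`, `a′ = s′ + k′a′`, `|k′| < 1` the SHARP bound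
  `|a′ − a| ≤ (|s′ − s| + |k′ − k|·|a|)/(1 − |k′|)` (closing `example`; `a′ − a = ((s′−s) + (k′−k)a)/(1 − k′)`).

THE SMALLNESS / GAP CENSUS (the binders of `idef_neumann_majorant[_rateWeight]`, = what an instantiation at node U1a must
supply; statuses are the cell records', not claims of this module):
(N1) UNIFORM CONVERGENCE OF THE FINE RUN'S EXPANSION, `q′ = κ₂′·m′ < 1` with `‖N′‖_ρ ≤ m′` — per kernel class a ONE-RUN
     statement of the printed kind ([B6] Lemma 2.1 (2.61)–(2.63) and (2.65) p. 234; [B9] Thms 3.7/3.9/3.10, (3.131));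
     hypothesis here; for REALISED geometries the printed `c₁(α)` of (2.61) is refuted as typed for `d ≥ 3` and consumers
     bind the repaired displays (`B6Lemma21Counterexample`, `B6Lemma21Repaired`; cell GAPS G-A11-1).
(N2) THE GAP: the coarse run's majorant at the BETTER rate `ρ + σ`, `σ = γ·ln L/(RM)` (`L ≥ 1`, `RM > 0`, `γ ≥ 0`,
     (2.60) with `αδ₀ > 0`) — i.e. `γ·ln L ≤ (ρ_coarse − ρ_defect)·RM`: the smallness of the rate exponent `γ`, located.
     With `w ≡ 1` (unit layer, `θ^k` a constant) there is no gap (`idef_neumann_majorant_flat`).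
(N3) THE PRIMITIVE DEFECT RATES `ε_S` (of `𝔇(S′,S)`, source-weighted, rate `ρ`) and `m_K` (of `𝔇(K′,K) = K′τ₂ − τ₂K`,
     weighted row norm) — NOT PRINTED (one run is constructed); this is where NE2⁺'s content now sits: the re-cut of
     `t4/T4-EST-U1a.md` §4 NE2-LOCAL-0s, -0v, -A (local pieces) feeding NE2-WALK/NE2-ALG (this module's mechanism); kernel
     instances exist only in the U = 1 layer (`T4Cov2156Rate`: `θ = L⁻¹` for [B6] (2.156); `T4Rate166StripDirect`;
     `T4Hk163StripRate`).  HONEST LIMIT (b) applies.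
(N4) AN A PRIORI (source-weighted constant) BOUND of `𝔇_A` — the finite lattice; from any unweighted one by
     `hasMaj_apriori_weighted` (positive weight); the same binder as `neumann_majorant_wrow`'s `hap`.
(N5) THE FIXED-POINT FORMS `A = S + KA`, `A′ = S′ + K′A′` — data: the printed expansions ARE of this form ((2.50),
     (2.86), (2.141) of [B6]; (3.90), (3.130)–(3.131) of [B9]; (188) of [Balaban1985Variational] p. 308 =
     `B11SectG.neumann_telescope`).
(N6) GEOMETRY: (2.54) `B6RandomWalk.Triangle254`, `d ≥ 0`, (2.60) `B6RandomWalk.Ineq260` (kernel for realised geometries,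
     `B6Geometry.ineq260_of_levelGap`) — hypotheses by name, as everywhere in `B11SectG`.

HONEST LIMITS.  (a) MECHANISM ONLY: spaces, operators, block norms, transports, majorants are data; the module proves the
bookkeeping implications between hypothesis shapes and nothing about Bałaban's propagators.  (b) THE PRIMITIVES CARRY
THE CONTENT: for a piecewise-constant pull-back `τ` the defect of a LOCAL operator, `𝔇(Δ′,Δ) = Δ′τ − τΔ`, is of order
one at the finest scales (consistent with the covariant weight: `(L^j)^{−γ} = O(1)` at `j = 0`, `t4/T4-EST-U1a.md` (R1))
and acquires a rate only on smooth inputs — i.e. in COMPOSITES such as `𝔇(Δ′,Δ)G` (`idef_inv`'s shape); which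
composites an instantiation bounds, and how (King §4 symbol estimates at U = 1; nothing printed at U ≠ 1), is NOT
addressed here.  (c) ONE transport per space: the two-sided bookkeeping of `T4EtaRate.EtaPairing` (site embedding ι,
test-function transport, background averaging) is collapsed into the linear maps `τ₁`, `τ₂` — data.  (d) The weight is
at the SOURCE site `y′`; the cell's `max` convention (GAPS G-t4-U1a-3) is recovered by `HasMaj.max_of_source` and costs
one tilt in the other direction (`HasMaj.source_of_max`).  (e) NOT NE2⁺, NOT node U1a closed, NOT an η-rate of any
printed object, NOT summit progress.

ABSOLUTE RULE (cell).  No internally-minted statement enters as a cited fact: every declaration below is kernel-proved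
from its displayed binders; the three verbatim quotations above are re-used from tree headers already cross-read against
the page renders (`B9.lean` Phase 2b p. 427, `T4EtaRate` (2) pp. 426–427, `B6.lean` Lemma 2.1 p. 234); the manuscripts
under audit are quoted for MECHANISM and SHAPE only, never for a disputed step; no programme-internal claim is cited.
References: [B6] = [Balaban1984PropagatorsII]; [B9] = [Balaban1985BackgroundPropagators]; [Balaban1985Variational];
[King1986].

v1.1 (2026-08-19, DOCSTRING-ONLY; declarations, statements and proofs byte-identical to v1 p187412): DOCFIX D1 of the
cross-read GAPS C-pv01-85 (pv01-g15) — the exponent signs in the docstring of `rateWeight_toB6` are corrected to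
`η^γ·(L^jη)^{−γ} = (η/L^jη)^γ = (L^j)^{−γ}` (the kernel statement was and is the correct identity); and its INFO I2 is
recorded here: the adapters `HasMaj.max_of_source` / `HasMaj.source_of_max` live in the namespace
`…T4EtaRateDefect.HasMaj`, so dot-notation on a `B11SectG.HasMaj` term does not find them — call them by full name.
-/

namespace Literature.MathematicalPhysics.QuantumFieldTheory.Balaban1983to89.T4EtaRateDefect

open Literature.MathematicalPhysics.QuantumFieldTheory.Balaban1983to89
open Finset B6RandomWalk B11SectG B9SectDWeightedNeumann

/-! ## §1 The intertwining defect of two runs' linear operators -/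

section Defect

variable {F₁ F₂ F₃ F₁' F₂' F₃' : Type} [AddCommGroup F₁] [Module ℝ F₁] [AddCommGroup F₂] [Module ℝ F₂]
  [AddCommGroup F₃] [Module ℝ F₃] [AddCommGroup F₁'] [Module ℝ F₁'] [AddCommGroup F₂'] [Module ℝ F₂']
  [AddCommGroup F₃'] [Module ℝ F₃']

/-- The INTERTWINING DEFECT of the fine-run operator `T′ : F₁′ → F₂′` against the coarse-run operator `T : F₁ → F₂`
through the transports `τ₁ : F₁ → F₁′` (inputs) and `τ₂ : F₂ → F₂′` (outputs): `𝔇(T′,T) = T′τ₁ − τ₂T : F₁ → F₂′`.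
[folklore] -/
def idef (τ₁ : F₁ →ₗ[ℝ] F₁') (τ₂ : F₂ →ₗ[ℝ] F₂') (T' : F₁' →ₗ[ℝ] F₂') (T : F₁ →ₗ[ℝ] F₂) : F₁ →ₗ[ℝ] F₂' :=
  T' ∘ₗ τ₁ - τ₂ ∘ₗ T

variable (τ₁ : F₁ →ₗ[ℝ] F₁') (τ₂ : F₂ →ₗ[ℝ] F₂') (τ₃ : F₃ →ₗ[ℝ] F₃')

/-- Pointwise form. [folklore] -/
@[simp] theorem idef_apply (T' : F₁' →ₗ[ℝ] F₂') (T : F₁ →ₗ[ℝ] F₂) (μ : F₁) :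
    idef τ₁ τ₂ T' T μ = T' (τ₁ μ) - τ₂ (T μ) := rfl

/-- LEIBNIZ RULE: `𝔇(T₁′T₂′, T₁T₂) = T₁′·𝔇(T₂′,T₂) + 𝔇(T₁′,T₁)·T₂` — fine-run factors LEFT of the defect, coarse-run
factors RIGHT of it. [folklore] -/
theorem idef_comp (T₁' : F₂' →ₗ[ℝ] F₃') (T₂' : F₁' →ₗ[ℝ] F₂') (T₁ : F₂ →ₗ[ℝ] F₃) (T₂ : F₁ →ₗ[ℝ] F₂) :
    idef τ₁ τ₃ (T₁' ∘ₗ T₂') (T₁ ∘ₗ T₂) = T₁' ∘ₗ idef τ₁ τ₂ T₂' T₂ + idef τ₂ τ₃ T₁' T₁ ∘ₗ T₂ := by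
  ext μ
  simp [idef, map_sub]

/-- Additivity. [folklore] -/
theorem idef_add (T' S' : F₁' →ₗ[ℝ] F₂') (T S : F₁ →ₗ[ℝ] F₂) :
    idef τ₁ τ₂ (T' + S') (T + S) = idef τ₁ τ₂ T' T + idef τ₁ τ₂ S' S := by
  ext μ
  simp [idef]
  abel

/-- Differences. [folklore] -/
theorem idef_sub (T' S' : F₁' →ₗ[ℝ] F₂') (T S : F₁ →ₗ[ℝ] F₂) :
    idef τ₁ τ₂ (T' - S') (T - S) = idef τ₁ τ₂ T' T - idef τ₁ τ₂ S' S := by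
  ext μ
  simp [idef]
  abel

/-- Scalars. [folklore] -/
theorem idef_smul (c : ℝ) (T' : F₁' →ₗ[ℝ] F₂') (T : F₁ →ₗ[ℝ] F₂) :
    idef τ₁ τ₂ (c • T') (c • T) = c • idef τ₁ τ₂ T' T := by
  ext μ
  simp [idef, smul_sub]

/-- The zero operators have no defect. [folklore] -/
@[simp] theorem idef_zero : idef τ₁ τ₂ (0 : F₁' →ₗ[ℝ] F₂') (0 : F₁ →ₗ[ℝ] F₂) = 0 := by
  ext μ
  simp [idef]

/-- THE FIXED-POINT IDENTITY.  If the coarse run's object solves `A = S + KA` and the fine run's `A′ = S′ + K′A′`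
(the Neumann / random-walk form), then the defect `𝔇_A = 𝔇(A′,A)` solves an equation OF THE SAME FORM with the fine
step operator: `𝔇_A = (𝔇_S + 𝔇_K·A) + K′·𝔇_A`, `𝔇_S = 𝔇(S′,S)`, `𝔇_K = 𝔇(K′,K) = K′τ₂ − τ₂K`. [folklore] -/
theorem idef_fix {K : Module.End ℝ F₂} {K' : Module.End ℝ F₂'} {S A : F₁ →ₗ[ℝ] F₂} {S' A' : F₁' →ₗ[ℝ] F₂'}
    (hfix : A = S + K ∘ₗ A) (hfix' : A' = S' + K' ∘ₗ A') :
    idef τ₁ τ₂ A' A = (idef τ₁ τ₂ S' S + idef τ₂ τ₂ K' K ∘ₗ A) + K' ∘ₗ idef τ₁ τ₂ A' A := by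
  have h : idef τ₁ τ₂ A' A = (S' + K' ∘ₗ A') ∘ₗ τ₁ - τ₂ ∘ₗ (S + K ∘ₗ A) := by
    rw [← hfix, ← hfix']
    rfl
  conv_lhs => rw [h]
  ext μ
  simp [idef, map_sub]
  abel

/-- THE EXACT INVERSE RULE (no series): if `G′` is a left inverse of `Δ′` and `G` a right inverse of `Δ`, then
`𝔇(G′,G) = −G′·𝔇(Δ′,Δ)·G` with the transports swapped inside — rate = stability × consistency. [folklore] -/
theorem idef_inv {G : F₁ →ₗ[ℝ] F₂} {Δ : F₂ →ₗ[ℝ] F₁} {G' : F₁' →ₗ[ℝ] F₂'} {Δ' : F₂' →ₗ[ℝ] F₁'}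
    (hG' : G' ∘ₗ Δ' = LinearMap.id) (hG : Δ ∘ₗ G = LinearMap.id) :
    idef τ₁ τ₂ G' G = -(G' ∘ₗ idef τ₂ τ₁ Δ' Δ ∘ₗ G) := by
  ext μ
  have h1 : ∀ x, G' (Δ' x) = x := fun x => by simpa using LinearMap.congr_fun hG' x
  have h2 : ∀ x, Δ (G x) = x := fun x => by simpa using LinearMap.congr_fun hG x
  simp [idef, map_sub, h1, h2]

end Defect

/-! ## §2 Source weights: reweighted block norms, slow weights, the one located rate loss -/

variable {g : B6.Geometry}
variable {F₁ F₂ F₃ F₁' F₂' F₃' : Type} [AddCommGroup F₁] [Module ℝ F₁] [AddCommGroup F₂] [Module ℝ F₂]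
  [AddCommGroup F₃] [Module ℝ F₃] [AddCommGroup F₁'] [Module ℝ F₁'] [AddCommGroup F₂'] [Module ℝ F₂']
  [AddCommGroup F₃'] [Module ℝ F₃']

/-- The block norm `b` REWEIGHTED by a nonnegative site weight `w`: `loc_w y f = w(y)·loc y f`, same cuts, same
localisation, same cutting cost. [folklore] -/
def wnorm (b : BlockNorm g F₁) (w : g.Site → ℝ) (hw : ∀ y, 0 ≤ w y) : BlockNorm g F₁ where
  loc y f := w y * b.loc y f
  cut := b.cut
  IsLoc := b.IsLoc
  κ := b.κ
  κ_nonneg := b.κ_nonneg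
  loc_nonneg y f := mul_nonneg (hw y) (b.loc_nonneg y f)
  loc_zero y := by rw [b.loc_zero, mul_zero]
  loc_add_le y f f' := by
    calc w y * b.loc y (f + f') ≤ w y * (b.loc y f + b.loc y f') :=
          mul_le_mul_of_nonneg_left (b.loc_add_le y f f') (hw y)
      _ = w y * b.loc y f + w y * b.loc y f' := mul_add _ _ _
  loc_neg y f := by rw [b.loc_neg]
  sum_cut := b.sum_cut
  isLoc_cut := b.isLoc_cut
  loc_cut_le y f := by
    calc w y * b.loc y (b.cut y f) ≤ w y * (b.κ * b.loc y f) :=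
          mul_le_mul_of_nonneg_left (b.loc_cut_le y f) (hw y)
      _ = b.κ * (w y * b.loc y f) := by ring

/-- A SOURCE-WEIGHTED majorant `K(y,y′)·w(y′)` IS an ordinary majorant `K` from the reweighted source norm — so every
lemma of `B11SectG` / `B9SectDWeightedNeumann` applies to source-weighted majorants verbatim. [folklore] -/
theorem hasMaj_wnorm_iff (b₁ : BlockNorm g F₁) (w : g.Site → ℝ) (hw : ∀ y, 0 ≤ w y) {b₂ : BlockNorm g F₂}
    {T : F₁ →ₗ[ℝ] F₂} {K : g.Site → g.Site → ℝ} :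
    HasMaj (wnorm b₁ w hw) b₂ T K ↔ HasMaj b₁ b₂ T (fun y y' => K y y' * w y') := by
  constructor
  · intro h y' μ hμ y
    have := h y' μ hμ y
    simpa [wnorm, mul_assoc] using this
  · intro h y' μ hμ y
    have := h y' μ hμ y
    simpa [wnorm, mul_assoc] using this

/-- A SLOW WEIGHT (log-Lipschitz in the multiscale distance): `w(y) ≤ C·w(y′)·e^{σd(y,y′)}` — the shape of (2.60) of
[B6] Lemma 2.1 for powers of the scale `L^j`; matrix-level sibling: `B9SectCDiffEstimate.Transfer`.
[cite: Balaban1984PropagatorsII, Lemma 2.1 (2.60) p.234 (shape)] -/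
def SlowWeight (g : B6.Geometry) (σ C : ℝ) (w : g.Site → ℝ) : Prop :=
  ∀ y y' : g.Site, w y ≤ C * w y' * Real.exp (σ * g.dist y y')

/-- A constant weight is slow with no tilt and no constant. [folklore] -/
theorem slowWeight_const (ε : ℝ) : SlowWeight g 0 1 (fun _ => ε) := by
  intro y y'
  simp

/-- THE ONE LOCATED RATE LOSS.  `T₁ : F₂ → F₃` with a majorant `N(y,y″)·w(y″)` weighted at ITS source (an
intermediate site of the composition, `‖N‖_ρ ≤ M`) after `T₂ : F₁ → F₂` with the exponential majorant `a·e^{−(ρ+σ)d}`: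
the weight moves from the intermediate site `y″` to the source `y′` at the cost of its tilt `σ` out of `T₂`'s rate and
its constant `C`, the rest is `conv_wrow_exp` (triangle inequality only): `T₁T₂` has the majorant
`κ₂MaC·e^{−ρd(y,y′)}·w(y′)`. [cite: Balaban1984PropagatorsII, (2.54) p.233 + (2.60) p.234 (shapes)] -/
theorem hasMaj_comp_transfer {b₁ : BlockNorm g F₁} {b₂ : BlockNorm g F₂} {b₃ : BlockNorm g F₃}
    {T₁ : F₂ →ₗ[ℝ] F₃} {T₂ : F₁ →ₗ[ℝ] F₂} {N : g.Site → g.Site → ℝ} {w : g.Site → ℝ} {M a ρ σ C : ℝ}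
    (htri : Triangle254 g) (hρ : 0 ≤ ρ) (ha : 0 ≤ a) (hC : 0 ≤ C) (hN : ∀ x y, 0 ≤ N x y) (hw : ∀ y, 0 ≤ w y)
    (hsw : SlowWeight g σ C w) (hM : WRow g ρ N M)
    (h₁ : HasMaj b₂ b₃ T₁ (fun y y'' => N y y'' * w y''))
    (h₂ : HasMaj b₁ b₂ T₂ (fun y'' y' => a * Real.exp (-((ρ + σ) * g.dist y'' y')))) :
    HasMaj b₁ b₃ (T₁ ∘ₗ T₂) (fun y y' => b₂.κ * M * a * C * Real.exp (-(ρ * g.dist y y')) * w y') := by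
  refine (hasMaj_comp h₁ h₂ fun x y => mul_nonneg (hN x y) (hw y)).mono fun y y' => ?_
  have hpt : ∀ y'' : g.Site, N y y'' * w y'' * (b₂.κ * (a * Real.exp (-((ρ + σ) * g.dist y'' y')))) ≤
      N y y'' * (b₂.κ * ((a * C * w y') * Real.exp (-(ρ * g.dist y'' y')))) := by
    intro y''
    have hexp : Real.exp (σ * g.dist y'' y') * Real.exp (-((ρ + σ) * g.dist y'' y')) =
        Real.exp (-(ρ * g.dist y'' y')) := by
      rw [← Real.exp_add]
      ring_nf
    have hkey : w y'' * Real.exp (-((ρ + σ) * g.dist y'' y')) ≤ C * w y' * Real.exp (-(ρ * g.dist y'' y')) := by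
      calc w y'' * Real.exp (-((ρ + σ) * g.dist y'' y'))
          ≤ (C * w y' * Real.exp (σ * g.dist y'' y')) * Real.exp (-((ρ + σ) * g.dist y'' y')) :=
            mul_le_mul_of_nonneg_right (hsw y'' y') (Real.exp_nonneg _)
        _ = C * w y' * Real.exp (-(ρ * g.dist y'' y')) := by rw [mul_assoc (C * w y'), hexp]
    have hNκa : 0 ≤ N y y'' * (b₂.κ * a) := mul_nonneg (hN _ _) (mul_nonneg b₂.κ_nonneg ha)
    calc N y y'' * w y'' * (b₂.κ * (a * Real.exp (-((ρ + σ) * g.dist y'' y'))))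
        = N y y'' * (b₂.κ * a) * (w y'' * Real.exp (-((ρ + σ) * g.dist y'' y'))) := by ring
      _ ≤ N y y'' * (b₂.κ * a) * (C * w y' * Real.exp (-(ρ * g.dist y'' y'))) :=
          mul_le_mul_of_nonneg_left hkey hNκa
      _ = N y y'' * (b₂.κ * ((a * C * w y') * Real.exp (-(ρ * g.dist y'' y')))) := by ring
  calc ∑ y'' : g.Site, N y y'' * w y'' * (b₂.κ * (a * Real.exp (-((ρ + σ) * g.dist y'' y'))))
      ≤ ∑ y'' : g.Site, N y y'' * (b₂.κ * ((a * C * w y') * Real.exp (-(ρ * g.dist y'' y')))) :=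
        Finset.sum_le_sum fun y'' _ => hpt y''
    _ ≤ b₂.κ * M * (a * C * w y') * Real.exp (-(ρ * g.dist y y')) :=
        conv_wrow_exp htri hρ b₂.κ_nonneg (mul_nonneg (mul_nonneg ha hC) (hw y')) hN hM y y'
    _ = b₂.κ * M * a * C * Real.exp (-(ρ * g.dist y y')) * w y' := by ring

/-- A weight sitting at the SOURCE rides through a left factor measured in the weighted row-sum norm for free (no
tilt): `T₁` (`‖N‖_ρ ≤ M`) after `T₂` (majorant `a·e^{−ρd}·w(y′)`) has majorant `κ₂Ma·e^{−ρd}·w(y′)` — this is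
`B9SectDWeightedNeumann.hasMaj_comp_wrow` read from the reweighted source norm. [cite: Balaban1984PropagatorsII, (2.54) p.233 (shape)] -/
theorem hasMaj_comp_wrow_source {b₁ : BlockNorm g F₁} {b₂ : BlockNorm g F₂} {b₃ : BlockNorm g F₃}
    {T₁ : F₂ →ₗ[ℝ] F₃} {T₂ : F₁ →ₗ[ℝ] F₂} {N : g.Site → g.Site → ℝ} {w : g.Site → ℝ} {M a ρ : ℝ}
    (htri : Triangle254 g) (hρ : 0 ≤ ρ) (ha : 0 ≤ a) (hN : ∀ x y, 0 ≤ N x y) (hw : ∀ y, 0 ≤ w y)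
    (hM : WRow g ρ N M) (h₁ : HasMaj b₂ b₃ T₁ N)
    (h₂ : HasMaj b₁ b₂ T₂ (fun y y' => a * Real.exp (-(ρ * g.dist y y')) * w y')) :
    HasMaj b₁ b₃ (T₁ ∘ₗ T₂) (fun y y' => b₂.κ * M * a * Real.exp (-(ρ * g.dist y y')) * w y') :=
  (hasMaj_wnorm_iff b₁ w hw).mp
    (hasMaj_comp_wrow htri hρ ha hN hM h₁ ((hasMaj_wnorm_iff b₁ w hw).mpr h₂))

/-- SOURCE form ⇒ MAX form (the `max` of the two sites' factors of `T4EtaRate.EtaRateIneq342`) for free. [folklore] -/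
theorem HasMaj.max_of_source {b₁ : BlockNorm g F₁} {b₂ : BlockNorm g F₂} {T : F₁ →ₗ[ℝ] F₂}
    {Kf : g.Site → g.Site → ℝ} {w : g.Site → ℝ} (hK : ∀ y y', 0 ≤ Kf y y')
    (h : HasMaj b₁ b₂ T (fun y y' => Kf y y' * w y')) :
    HasMaj b₁ b₂ T (fun y y' => Kf y y' * max (w y) (w y')) :=
  h.mono fun y y' => mul_le_mul_of_nonneg_left (le_max_right _ _) (hK y y')

/-- MAX form ⇒ SOURCE form at the cost of one tilt and the constant (slow weight, `C ≥ 1`). [folklore] -/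
theorem HasMaj.source_of_max {b₁ : BlockNorm g F₁} {b₂ : BlockNorm g F₂} {T : F₁ →ₗ[ℝ] F₂}
    {w : g.Site → ℝ} {a ρ σ C : ℝ} (hd : ∀ x y : g.Site, 0 ≤ g.dist x y) (ha : 0 ≤ a) (hC : 1 ≤ C)
    (hσ : 0 ≤ σ) (hw : ∀ y, 0 ≤ w y) (hsw : SlowWeight g σ C w)
    (h : HasMaj b₁ b₂ T (fun y y' => a * Real.exp (-((ρ + σ) * g.dist y y')) * max (w y) (w y'))) :
    HasMaj b₁ b₂ T (fun y y' => a * C * Real.exp (-(ρ * g.dist y y')) * w y') := by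
  refine h.mono fun y y' => ?_
  have hE : 1 ≤ Real.exp (σ * g.dist y y') := Real.one_le_exp (mul_nonneg hσ (hd y y'))
  have hmax : max (w y) (w y') ≤ C * w y' * Real.exp (σ * g.dist y y') := by
    refine max_le (hsw y y') ?_
    calc w y' = 1 * w y' * 1 := by ring
      _ ≤ C * w y' * Real.exp (σ * g.dist y y') :=
          mul_le_mul (mul_le_mul_of_nonneg_right hC (hw y')) hE zero_le_one
            (mul_nonneg (le_trans zero_le_one hC) (hw y'))
  have hexp : Real.exp (-((ρ + σ) * g.dist y y')) * Real.exp (σ * g.dist y y') = Real.exp (-(ρ * g.dist y y')) := by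
    rw [← Real.exp_add]
    ring_nf
  calc a * Real.exp (-((ρ + σ) * g.dist y y')) * max (w y) (w y')
      ≤ a * Real.exp (-((ρ + σ) * g.dist y y')) * (C * w y' * Real.exp (σ * g.dist y y')) :=
        mul_le_mul_of_nonneg_left hmax (mul_nonneg ha (Real.exp_nonneg _))
    _ = a * C * (Real.exp (-((ρ + σ) * g.dist y y')) * Real.exp (σ * g.dist y y')) * w y' := by ring
    _ = a * C * Real.exp (-(ρ * g.dist y y')) * w y' := by rw [hexp]

/-! ## §3 The defect of two Neumann fixed points, of compositions, of inverses -/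

/-- A source-weighted A PRIORI bound from an unweighted one when the weight is positive (finite 𝔅): constant majorant
`M₁` ⇒ majorant `(M₁·Σ_y w(y)⁻¹)·w(y′)`. [folklore] -/
theorem hasMaj_apriori_weighted {b₁ : BlockNorm g F₁} {b₂ : BlockNorm g F₂} {T : F₁ →ₗ[ℝ] F₂} {w : g.Site → ℝ}
    {M₁ : ℝ} (hM₁ : 0 ≤ M₁) (hw : ∀ y, 0 < w y) (h : HasMaj b₁ b₂ T (fun _ _ => M₁)) :
    HasMaj b₁ b₂ T (fun _ y' => (M₁ * ∑ y : g.Site, (w y)⁻¹) * w y') := by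
  refine h.mono fun y y' => ?_
  have hsum : (w y')⁻¹ ≤ ∑ z : g.Site, (w z)⁻¹ :=
    Finset.single_le_sum (f := fun z => (w z)⁻¹) (fun z _ => (inv_pos.mpr (hw z)).le) (Finset.mem_univ y')
  calc M₁ = M₁ * (w y')⁻¹ * w y' := by rw [mul_assoc, inv_mul_cancel₀ (hw y').ne', mul_one]
    _ ≤ M₁ * (∑ z : g.Site, (w z)⁻¹) * w y' :=
        mul_le_mul_of_nonneg_right (mul_le_mul_of_nonneg_left hsum hM₁) (hw y').le

/-- **THE η-RATE OF A NEUMANN / RANDOM-WALK EXPANSION IS INHERITED FROM THE η-RATES OF ITS SOURCE AND ITS STEP —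
KERNEL-CHECKED, with one located rate loss.**  Coarse run: `A = S + KA` with the (already assembled) majorant
`A∞·e^{−(ρ+σ)d}` from `b₁` to `b₂`.  Fine run: `A′ = S′ + K′A′`, the step `K′` given only by a majorant `N′ ≥ 0` with
`‖N′‖_ρ ≤ m′` and `q′ := κ₂′m′ < 1` (uniform convergence of the fine expansion).  Primitive defects, weighted at the
SOURCE by a slow weight `w ≥ 0` (tilt `σ`, constant `C`): `𝔇_S = 𝔇(S′,S)` with `ε_S·e^{−ρd}·w(y′)`, `𝔇_K = K′τ₂ − τ₂K`
with `N_K(y,y″)·w(y″)`, `‖N_K‖_ρ ≤ m_K`; and an a priori (source-weighted constant) bound of `𝔇_A` (the finite lattice;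
`hasMaj_apriori_weighted`).  THEN `𝔇_A = A′τ₁ − τ₂A` has the majorant
`(ε_S + κ₂m_KA∞C)(1 − q′)⁻¹·e^{−ρd(y,y′)}·w(y′)`.  Proof: `idef_fix` puts `𝔇_A` in the fixed-point form with source
`𝔇_S + 𝔇_K·A` (the weight of `𝔇_K` moved to the source by `hasMaj_comp_transfer` — THE rate loss), and
`B9SectDWeightedNeumann.neumann_majorant_wrow` runs the fine Neumann series from the reweighted source norm `wnorm b₁ w`.
Mechanism of `t4/T4-EST-U1a.md` §3 STEP 0/3 (NE2-WALK/NE2-ALG); nothing of [B6]/[B9] asserted.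
[cite: Balaban1985BackgroundPropagators, Thm 3.14 pp.426–427 + proof sketch p.427 (mechanism, domain differences);
Balaban1985Variational, (188) p.308 (Neumann form); Balaban1984PropagatorsII, Lemma 2.1 (2.60)–(2.61) p.234 (shapes)] -/
theorem idef_neumann_majorant
    {b₁ : BlockNorm g F₁} {b₂ : BlockNorm g F₂} {b₂' : BlockNorm g F₂'}
    {τ₁ : F₁ →ₗ[ℝ] F₁'} {τ₂ : F₂ →ₗ[ℝ] F₂'}
    {K : Module.End ℝ F₂} {K' : Module.End ℝ F₂'} {S A : F₁ →ₗ[ℝ] F₂} {S' A' : F₁' →ₗ[ℝ] F₂'}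
    {N_K N' : g.Site → g.Site → ℝ} {w : g.Site → ℝ} {εS mK m' A₀ M₀ ρ σ C : ℝ}
    (htri : Triangle254 g) (hd : ∀ a b : g.Site, 0 ≤ g.dist a b) (hρ : 0 ≤ ρ)
    (hw : ∀ y, 0 ≤ w y) (hsw : SlowWeight g σ C w) (hC : 0 ≤ C)
    (hεS : 0 ≤ εS) (hA₀ : 0 ≤ A₀) (hM₀ : 0 ≤ M₀)
    (hNK : ∀ x y, 0 ≤ N_K x y) (hmK : WRow g ρ N_K mK) (hN' : ∀ x y, 0 ≤ N' x y) (hm' : WRow g ρ N' m')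
    (hfix : A = S + K ∘ₗ A) (hfix' : A' = S' + K' ∘ₗ A')
    (hA : HasMaj b₁ b₂ A (fun y y' => A₀ * Real.exp (-((ρ + σ) * g.dist y y'))))
    (hK' : HasMaj b₂' b₂' K' N')
    (hDS : HasMaj b₁ b₂' (idef τ₁ τ₂ S' S) (fun y y' => εS * Real.exp (-(ρ * g.dist y y')) * w y'))
    (hDK : HasMaj b₂ b₂' (idef τ₂ τ₂ K' K) (fun y y' => N_K y y' * w y'))
    (hap : HasMaj b₁ b₂' (idef τ₁ τ₂ A' A) (fun _ y' => M₀ * w y'))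
    (hq' : b₂'.κ * m' < 1) :
    HasMaj b₁ b₂' (idef τ₁ τ₂ A' A)
      (fun y y' => (εS + b₂.κ * mK * A₀ * C) * (1 - b₂'.κ * m')⁻¹ * Real.exp (-(ρ * g.dist y y')) * w y') := by
  intro y₀' μ₀ hμ₀ y₀
  have hmK0 : 0 ≤ mK := hmK.nonneg hNK y₀
  -- the source term of the defect's fixed-point equation, with the weight moved to the source
  have hT : HasMaj b₁ b₂' (idef τ₁ τ₂ S' S + idef τ₂ τ₂ K' K ∘ₗ A)
      (fun y y' => (εS + b₂.κ * mK * A₀ * C) * Real.exp (-(ρ * g.dist y y')) * w y') := by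
    have h2 := hasMaj_comp_transfer htri hρ hA₀ hC hNK hw hsw hmK hDK hA
    refine (hDS.add h2).mono fun y y' => le_of_eq ?_
    ring
  -- the fine Neumann series from the reweighted source norm
  have key : HasMaj (wnorm b₁ w hw) b₂' (idef τ₁ τ₂ A' A)
      (fun y y' => (εS + b₂.κ * mK * A₀ * C) * (1 - b₂'.κ * m')⁻¹ * Real.exp (-(ρ * g.dist y y'))) :=
    neumann_majorant_wrow (b₁ := wnorm b₁ w hw) htri hd hρ hN' hm'
      (add_nonneg hεS (mul_nonneg (mul_nonneg (mul_nonneg b₂.κ_nonneg hmK0) hA₀) hC)) hM₀ hK'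
      ((hasMaj_wnorm_iff b₁ w hw (K := fun y y' => (εS + b₂.κ * mK * A₀ * C) * Real.exp (-(ρ * g.dist y y')))).mpr hT)
      (idef_fix τ₁ τ₂ hfix hfix')
      ((hasMaj_wnorm_iff b₁ w hw (K := fun _ _ => M₀)).mpr hap) hq'
  exact (hasMaj_wnorm_iff b₁ w hw).mp key y₀' μ₀ hμ₀ y₀


/-- THE UNIT-LAYER / FLAT-WEIGHT CASE (`w ≡ 1`, no tilt, no constant): the defect of the two fixed points inherits
the common rate `ρ` with constant `(ε_S + κ₂m_KA∞)(1 − q′)⁻¹` — e.g. an η-rate carried as a plain factor `θ^k` in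
`ε_S`, `N_K` (the U=1 modules `T4Cov2156Rate`, `T4Rate166StripDirect`, `T4Hk163StripRate`). [folklore] -/
theorem idef_neumann_majorant_flat
    {b₁ : BlockNorm g F₁} {b₂ : BlockNorm g F₂} {b₂' : BlockNorm g F₂'}
    {τ₁ : F₁ →ₗ[ℝ] F₁'} {τ₂ : F₂ →ₗ[ℝ] F₂'}
    {K : Module.End ℝ F₂} {K' : Module.End ℝ F₂'} {S A : F₁ →ₗ[ℝ] F₂} {S' A' : F₁' →ₗ[ℝ] F₂'}
    {N_K N' : g.Site → g.Site → ℝ} {εS mK m' A₀ M₀ ρ : ℝ}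
    (htri : Triangle254 g) (hd : ∀ a b : g.Site, 0 ≤ g.dist a b) (hρ : 0 ≤ ρ)
    (hεS : 0 ≤ εS) (hA₀ : 0 ≤ A₀) (hM₀ : 0 ≤ M₀)
    (hNK : ∀ x y, 0 ≤ N_K x y) (hmK : WRow g ρ N_K mK) (hN' : ∀ x y, 0 ≤ N' x y) (hm' : WRow g ρ N' m')
    (hfix : A = S + K ∘ₗ A) (hfix' : A' = S' + K' ∘ₗ A')
    (hA : HasMaj b₁ b₂ A (fun y y' => A₀ * Real.exp (-(ρ * g.dist y y'))))
    (hK' : HasMaj b₂' b₂' K' N')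
    (hDS : HasMaj b₁ b₂' (idef τ₁ τ₂ S' S) (fun y y' => εS * Real.exp (-(ρ * g.dist y y'))))
    (hDK : HasMaj b₂ b₂' (idef τ₂ τ₂ K' K) N_K)
    (hap : HasMaj b₁ b₂' (idef τ₁ τ₂ A' A) (fun _ _ => M₀))
    (hq' : b₂'.κ * m' < 1) :
    HasMaj b₁ b₂' (idef τ₁ τ₂ A' A)
      (fun y y' => (εS + b₂.κ * mK * A₀) * (1 - b₂'.κ * m')⁻¹ * Real.exp (-(ρ * g.dist y y'))) := by
  have key := idef_neumann_majorant (w := fun _ => (1 : ℝ)) (σ := 0) (C := 1) htri hd hρ (fun _ => zero_le_one)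
    (slowWeight_const 1) zero_le_one hεS hA₀ hM₀ hNK hmK hN' hm' hfix hfix'
    (by simpa only [add_zero] using hA) hK' (by simpa only [mul_one] using hDS)
    (by simpa only [mul_one] using hDK) (by simpa only [mul_one] using hap) hq'
  simpa only [mul_one] using key

/-- THE SAME WITH THE COARSE RUN'S MAJORANT ASSEMBLED FROM ITS OWN PRIMITIVES (`B9SectDWeightedNeumann.neumann_majorant_wrow`
at the better rate `ρ + σ`): `A∞ = A_S(1 − q)⁻¹`, `q = κ₂m < 1`.  Both runs' expansions converge uniformly; the defect
inherits rate `ρ` = the coarse rate minus the weight's tilt. [folklore] -/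
theorem idef_neumann_majorant_of_primitives
    {b₁ : BlockNorm g F₁} {b₂ : BlockNorm g F₂} {b₂' : BlockNorm g F₂'}
    {τ₁ : F₁ →ₗ[ℝ] F₁'} {τ₂ : F₂ →ₗ[ℝ] F₂'}
    {K : Module.End ℝ F₂} {K' : Module.End ℝ F₂'} {S A : F₁ →ₗ[ℝ] F₂} {S' A' : F₁' →ₗ[ℝ] F₂'}
    {N N_K N' : g.Site → g.Site → ℝ} {w : g.Site → ℝ} {εS A_S m mK m' M_A M₀ ρ σ C : ℝ}
    (htri : Triangle254 g) (hd : ∀ a b : g.Site, 0 ≤ g.dist a b) (hρ : 0 ≤ ρ) (hσ : 0 ≤ σ)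
    (hw : ∀ y, 0 ≤ w y) (hsw : SlowWeight g σ C w) (hC : 0 ≤ C)
    (hεS : 0 ≤ εS) (hAS : 0 ≤ A_S) (hMA : 0 ≤ M_A) (hM₀ : 0 ≤ M₀)
    (hN : ∀ x y, 0 ≤ N x y) (hm : WRow g (ρ + σ) N m)
    (hNK : ∀ x y, 0 ≤ N_K x y) (hmK : WRow g ρ N_K mK) (hN' : ∀ x y, 0 ≤ N' x y) (hm' : WRow g ρ N' m')
    (hfix : A = S + K ∘ₗ A) (hfix' : A' = S' + K' ∘ₗ A')
    (hK : HasMaj b₂ b₂ K N) (hS : HasMaj b₁ b₂ S (fun y y' => A_S * Real.exp (-((ρ + σ) * g.dist y y'))))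
    (hapA : HasMaj b₁ b₂ A (fun _ _ => M_A)) (hq : b₂.κ * m < 1)
    (hK' : HasMaj b₂' b₂' K' N')
    (hDS : HasMaj b₁ b₂' (idef τ₁ τ₂ S' S) (fun y y' => εS * Real.exp (-(ρ * g.dist y y')) * w y'))
    (hDK : HasMaj b₂ b₂' (idef τ₂ τ₂ K' K) (fun y y' => N_K y y' * w y'))
    (hap : HasMaj b₁ b₂' (idef τ₁ τ₂ A' A) (fun _ y' => M₀ * w y'))
    (hq' : b₂'.κ * m' < 1) :
    HasMaj b₁ b₂' (idef τ₁ τ₂ A' A)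
      (fun y y' => (εS + b₂.κ * mK * (A_S * (1 - b₂.κ * m)⁻¹) * C) * (1 - b₂'.κ * m')⁻¹ *
        Real.exp (-(ρ * g.dist y y')) * w y') := by
  have hA := neumann_majorant_wrow htri hd (add_nonneg hρ hσ) hN hm hAS hMA hK hS hfix hapA hq
  exact idef_neumann_majorant htri hd hρ hw hsw hC hεS
    (mul_nonneg hAS (inv_nonneg.mpr (sub_nonneg.mpr hq.le))) hM₀ hNK hmK hN' hm' hfix hfix' hA hK' hDS hDK hap hq'

/-- THE DEFECT OF A COMPOSITION (Leibniz + one located loss): `𝔇(T₁′T₂′,T₁T₂) = T₁′𝔇₂ + 𝔇₁T₂`; the fine left factor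
`T₁′` (`‖N₁′‖_ρ ≤ m₁′`) passes the source weight of `𝔇₂` for free, the coarse right factor `T₂` (rate `ρ + σ`) absorbs
the tilt of the weight of `𝔇₁`. [folklore] -/
theorem idef_comp_majorant
    {b₁ : BlockNorm g F₁} {b₂ : BlockNorm g F₂} {b₂' : BlockNorm g F₂'} {b₃' : BlockNorm g F₃'}
    {τ₁ : F₁ →ₗ[ℝ] F₁'} {τ₂ : F₂ →ₗ[ℝ] F₂'} {τ₃ : F₃ →ₗ[ℝ] F₃'}
    {T₁' : F₂' →ₗ[ℝ] F₃'} {T₂' : F₁' →ₗ[ℝ] F₂'} {T₁ : F₂ →ₗ[ℝ] F₃} {T₂ : F₁ →ₗ[ℝ] F₂}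
    {N₁' N₁ : g.Site → g.Site → ℝ} {w : g.Site → ℝ} {m₁' M₁ ε₂ a₂ ρ σ C : ℝ}
    (htri : Triangle254 g) (hρ : 0 ≤ ρ) (hw : ∀ y, 0 ≤ w y) (hsw : SlowWeight g σ C w) (hC : 0 ≤ C)
    (hε₂ : 0 ≤ ε₂) (ha₂ : 0 ≤ a₂)
    (hN₁' : ∀ x y, 0 ≤ N₁' x y) (hm₁' : WRow g ρ N₁' m₁') (hN₁ : ∀ x y, 0 ≤ N₁ x y) (hM₁ : WRow g ρ N₁ M₁)
    (hT₁' : HasMaj b₂' b₃' T₁' N₁')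
    (hD₂ : HasMaj b₁ b₂' (idef τ₁ τ₂ T₂' T₂) (fun y y' => ε₂ * Real.exp (-(ρ * g.dist y y')) * w y'))
    (hD₁ : HasMaj b₂ b₃' (idef τ₂ τ₃ T₁' T₁) (fun y y' => N₁ y y' * w y'))
    (hT₂ : HasMaj b₁ b₂ T₂ (fun y y' => a₂ * Real.exp (-((ρ + σ) * g.dist y y')))) :
    HasMaj b₁ b₃' (idef τ₁ τ₃ (T₁' ∘ₗ T₂') (T₁ ∘ₗ T₂))
      (fun y y' => (b₂'.κ * m₁' * ε₂ + b₂.κ * M₁ * a₂ * C) * Real.exp (-(ρ * g.dist y y')) * w y') := by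
  rw [idef_comp τ₁ τ₂ τ₃]
  have h1 := hasMaj_comp_wrow_source htri hρ hε₂ hN₁' hw hm₁' hT₁' hD₂
  have h2 := hasMaj_comp_transfer htri hρ ha₂ hC hN₁ hw hsw hM₁ hD₁ hT₂
  refine (h1.add h2).mono fun y y' => le_of_eq ?_
  ring

/-- THE DEFECT OF AN INVERSE, estimated (`idef_inv`: `𝔇(G′,G) = −G′𝔇(Δ′,Δ)G`): fine `G′` with `‖N_G‖_ρ ≤ m_G`, coarse
`G` at rate `ρ + σ`, the defect of the (local) operators `𝔇(Δ′,Δ)` source-weighted with `‖N_Δ‖_ρ ≤ m_Δ` ⇒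
`𝔇(G′,G)` has majorant `κ₁′m_G·κ₂m_Δ·a·C·e^{−ρd}·w(y′)`. [folklore] -/
theorem idef_inv_majorant
    {b₁ : BlockNorm g F₁} {b₂ : BlockNorm g F₂} {b₁' : BlockNorm g F₁'} {b₂' : BlockNorm g F₂'}
    {τ₁ : F₁ →ₗ[ℝ] F₁'} {τ₂ : F₂ →ₗ[ℝ] F₂'}
    {G : F₁ →ₗ[ℝ] F₂} {Δ : F₂ →ₗ[ℝ] F₁} {G' : F₁' →ₗ[ℝ] F₂'} {Δ' : F₂' →ₗ[ℝ] F₁'}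
    {N_G N_Δ : g.Site → g.Site → ℝ} {w : g.Site → ℝ} {m_G m_Δ a ρ σ C : ℝ}
    (htri : Triangle254 g) (hρ : 0 ≤ ρ) (hw : ∀ y, 0 ≤ w y) (hsw : SlowWeight g σ C w) (hC : 0 ≤ C)
    (ha : 0 ≤ a) (hNG : ∀ x y, 0 ≤ N_G x y) (hmG : WRow g ρ N_G m_G) (hNΔ : ∀ x y, 0 ≤ N_Δ x y)
    (hmΔ : WRow g ρ N_Δ m_Δ) (hinv' : G' ∘ₗ Δ' = LinearMap.id) (hinv : Δ ∘ₗ G = LinearMap.id)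
    (hG' : HasMaj b₁' b₂' G' N_G)
    (hDΔ : HasMaj b₂ b₁' (idef τ₂ τ₁ Δ' Δ) (fun y y' => N_Δ y y' * w y'))
    (hG : HasMaj b₁ b₂ G (fun y y' => a * Real.exp (-((ρ + σ) * g.dist y y')))) :
    HasMaj b₁ b₂' (idef τ₁ τ₂ G' G)
      (fun y y' => b₁'.κ * m_G * (b₂.κ * m_Δ * a * C) * Real.exp (-(ρ * g.dist y y')) * w y') := by
  rw [idef_inv τ₁ τ₂ hinv' hinv]
  intro y₀' μ₀ hμ₀ y₀
  have hmΔ0 : 0 ≤ m_Δ := hmΔ.nonneg hNΔ y₀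
  have h1 := hasMaj_comp_transfer htri hρ ha hC hNΔ hw hsw hmΔ hDΔ hG
  have h2 := hasMaj_comp_wrow_source htri hρ
    (mul_nonneg (mul_nonneg (mul_nonneg b₂.κ_nonneg hmΔ0) ha) hC) hNG hw hmG hG' h1
  exact h2.neg y₀' μ₀ hμ₀ y₀

/-! ## §4 The η-rate weight is slow: (2.60) locates the loss (the smallness of the rate exponent γ) -/

/-- THE η-RATE WEIGHT `w_γ(y) = (L^j)^{−γ}` for `y ∈ Λ_j` — the site-dependent part of the rate factor
`T4EtaRate.rateFactor g γ y = (η/L^jη)^γ = (L^j)^{−γ}` (King's `L^{−γk}(L^jη)^{−γ}` of (3.73) rewritten covariantly,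
`T4EtaRate.rateFactor_eq_king`; dictionary `rateWeight_toB6` below), typed on the [B6] geometry carrier so that it can
weight `B11SectG` block majorants. [cite: King1986, Prop. 3.9 (3.73) p.665 (rate factor, shape)] -/
noncomputable def rateWeight (g : B6.Geometry) (γ : ℝ) (y : g.Site) : ℝ := (g.L ^ g.scale y) ^ (-γ)

/-- Positivity. [folklore] -/
theorem rateWeight_pos {γ : ℝ} (hL : 0 < g.L) (y : g.Site) : 0 < rateWeight g γ y :=
  Real.rpow_pos_of_pos (pow_pos hL _) _

/-- Exponential form `w_γ(y) = e^{−γ·ln L·j}`. [folklore] -/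
theorem rateWeight_eq_exp {γ : ℝ} (hL : 0 < g.L) (y : g.Site) :
    rateWeight g γ y = Real.exp (-(γ * Real.log g.L * g.scale y)) := by
  unfold rateWeight
  rw [Real.rpow_def_of_pos (pow_pos hL _), Real.log_pow]
  ring_nf

/-- **THE η-RATE WEIGHT IS SLOW, WITH TILT `σ = γ·ln L/(RM)` AND CONSTANT `L^γ`** under the level gap of (2.60)
(`B11KernelDictionary.LevelGap`, from `Ineq260` by `B11KernelDictionary.levelGap_of_ineq260`):
`w_γ(y) ≤ L^γ·w_γ(y′)·e^{σd(y,y′)}` — the real-exponent form of the integer-power exchanges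
`B9SectDL2Decay.pow_scale_le_of_ineq260` / `inv_len_pow_le_of_ineq260` and `B11KernelDictionary.len_le_exchange`.
This is where the smallness of the rate exponent `γ` (King's `L^{−γk}` of (3.73)) is LOCATED in the walk bookkeeping:
the tilt must fit inside the decay margin, `ρ_defect + γ·ln L/(RM) ≤ ρ_coarse` in `idef_neumann_majorant`.
[cite: Balaban1984PropagatorsII, Lemma 2.1 (2.60) p.234; King1986, Prop. 3.9 (3.73) p.665 (the exponent γ)] -/
theorem slowWeight_rateWeight {γ : ℝ} (hL : 1 ≤ g.L) (hγ : 0 ≤ γ) (hRM : 0 < g.R * g.M)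
    (hgap : B11KernelDictionary.LevelGap g) :
    SlowWeight g (γ * Real.log g.L / (g.R * g.M)) (g.L ^ γ) (rateWeight g γ) := by
  intro y y'
  have hL0 : 0 < g.L := lt_of_lt_of_le zero_lt_one hL
  have hlog : 0 ≤ Real.log g.L := Real.log_nonneg hL
  rw [rateWeight_eq_exp hL0, rateWeight_eq_exp hL0,
    show g.L ^ γ = Real.exp (Real.log g.L * γ) from Real.rpow_def_of_pos hL0 γ, ← Real.exp_add, ← Real.exp_add,
    Real.exp_le_exp]
  have hss : (g.scale y' : ℝ) - g.scale y ≤ 1 + g.dist y y' / (g.R * g.M) := by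
    have h1 : (g.scale y' : ℝ) - g.scale y ≤ |(g.scale y : ℝ) - g.scale y'| := by
      rw [abs_sub_comm]
      exact le_abs_self _
    have h2 : |(g.scale y : ℝ) - g.scale y'| - 1 ≤ g.dist y y' / (g.R * g.M) := by
      rw [le_div_iff₀ hRM]
      linarith [hgap y y', mul_comm (g.R * g.M) (|(g.scale y : ℝ) - g.scale y'| - 1)]
    linarith
  have hc : 0 ≤ γ * Real.log g.L := mul_nonneg hγ hlog
  have h3 := mul_le_mul_of_nonneg_left hss hc
  have h4 : γ * Real.log g.L * (1 + g.dist y y' / (g.R * g.M)) =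
      Real.log g.L * γ + γ * Real.log g.L / (g.R * g.M) * g.dist y y' := by ring
  linarith

/-- Hence, under [B6] (2.60) (`B6RandomWalk.Ineq260`, kernel-derived for realised geometries by
`B6Geometry.ineq260_of_levelGap`) with `αδ₀ > 0`, `RM > 0`, `L ≥ 1`, `γ ≥ 0`: the η-rate weight is slow with tilt
`γ·ln L/(RM)` and constant `L^γ`. [cite: Balaban1984PropagatorsII, Lemma 2.1 (2.60) p.234] -/
theorem slowWeight_rateWeight_of_ineq260 {γ δ₀ α : ℝ} (h : Ineq260 g δ₀ α) (hαδ : 0 < α * δ₀)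
    (hL : 1 ≤ g.L) (hγ : 0 ≤ γ) (hRM : 0 < g.R * g.M) :
    SlowWeight g (γ * Real.log g.L / (g.R * g.M)) (g.L ^ γ) (rateWeight g γ) :=
  slowWeight_rateWeight hL hγ hRM (B11KernelDictionary.levelGap_of_ineq260 hαδ hRM.le h)

/-- DICTIONARY to the [B9]-side rate factor: on the [B6]-view `B9Thm34Ext.toB6` of a [B9] geometry (`η ≠ 0`, `L > 0`)
the η-rate weight IS `T4EtaRate.rateFactor` (`= η^γ·(L^jη)^{−γ} = (η/L^jη)^γ = (L^j)^{−γ}`,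
`T4EtaRate.rateFactor_eq_rpow_scale`). [folklore] -/
theorem rateWeight_toB6 (g₉ : B9.Geometry) [Fintype g₉.Site] (R : ℝ) (H : Prop) (hη : g₉.eta ≠ 0)
    (hL : 0 < g₉.L) (γ : ℝ) (y : g₉.Site) :
    rateWeight (B9Thm34Ext.toB6 g₉ R H) γ y = T4EtaRate.rateFactor g₉ γ y := by
  rw [T4EtaRate.rateFactor_eq_rpow_scale hη hL]
  rfl


/-- **THE η-RATE FORM (node U1a's deliverable shape, mechanism only).**  `idef_neumann_majorant` with the η-rate
weight `w_γ = (L^j)^{−γ}` under [B6] (2.60): if the coarse run's fixed point has a majorant at rate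
`ρ + γ·ln L/(RM)`, the fine run's expansion converges uniformly (`κ₂′m′ < 1` at rate `ρ`), and the primitive defects
`𝔇(S′,S)`, `𝔇(K′,K)` carry the factor `(L^{j′})^{−γ}` of their source site at rate `ρ`, then so does the defect of the
fixed points, with constant `(ε_S + κ₂m_KA∞L^γ)(1 − κ₂′m′)⁻¹`.  (On the [B6]-view of a [B9] geometry the weight IS
`T4EtaRate.rateFactor` at the source site, `rateWeight_toB6`; the `max` form of `T4EtaRate.EtaRateIneq342` follows by
`HasMaj.max_of_source`.)  NOT an instance of NE2⁺: the three primitive inputs are hypotheses (HONEST LIMITS). [cite: Balaban1984PropagatorsII, Lemma 2.1 (2.60) p.234;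
Balaban1985BackgroundPropagators, Thm 3.14 proof sketch p.427 (mechanism); King1986, Prop. 3.9 (3.73) p.665 (rate factor)] -/
theorem idef_neumann_majorant_rateWeight
    {b₁ : BlockNorm g F₁} {b₂ : BlockNorm g F₂} {b₂' : BlockNorm g F₂'}
    {τ₁ : F₁ →ₗ[ℝ] F₁'} {τ₂ : F₂ →ₗ[ℝ] F₂'}
    {K : Module.End ℝ F₂} {K' : Module.End ℝ F₂'} {S A : F₁ →ₗ[ℝ] F₂} {S' A' : F₁' →ₗ[ℝ] F₂'}
    {N_K N' : g.Site → g.Site → ℝ} {εS mK m' A₀ M₀ ρ γ δ₀ α : ℝ}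
    (htri : Triangle254 g) (hd : ∀ a b : g.Site, 0 ≤ g.dist a b) (hρ : 0 ≤ ρ)
    (h260 : Ineq260 g δ₀ α) (hαδ : 0 < α * δ₀) (hL : 1 ≤ g.L) (hγ : 0 ≤ γ) (hRM : 0 < g.R * g.M)
    (hεS : 0 ≤ εS) (hA₀ : 0 ≤ A₀) (hM₀ : 0 ≤ M₀)
    (hNK : ∀ x y, 0 ≤ N_K x y) (hmK : WRow g ρ N_K mK) (hN' : ∀ x y, 0 ≤ N' x y) (hm' : WRow g ρ N' m')
    (hfix : A = S + K ∘ₗ A) (hfix' : A' = S' + K' ∘ₗ A')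
    (hA : HasMaj b₁ b₂ A (fun y y' => A₀ * Real.exp (-((ρ + γ * Real.log g.L / (g.R * g.M)) * g.dist y y'))))
    (hK' : HasMaj b₂' b₂' K' N')
    (hDS : HasMaj b₁ b₂' (idef τ₁ τ₂ S' S) (fun y y' => εS * Real.exp (-(ρ * g.dist y y')) * rateWeight g γ y'))
    (hDK : HasMaj b₂ b₂' (idef τ₂ τ₂ K' K) (fun y y' => N_K y y' * rateWeight g γ y'))
    (hap : HasMaj b₁ b₂' (idef τ₁ τ₂ A' A) (fun _ y' => M₀ * rateWeight g γ y'))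
    (hq' : b₂'.κ * m' < 1) :
    HasMaj b₁ b₂' (idef τ₁ τ₂ A' A)
      (fun y y' => (εS + b₂.κ * mK * A₀ * g.L ^ γ) * (1 - b₂'.κ * m')⁻¹ * Real.exp (-(ρ * g.dist y y')) *
        rateWeight g γ y') :=
  idef_neumann_majorant htri hd hρ (fun y => (rateWeight_pos (lt_of_lt_of_le one_pos hL) y).le)
    (slowWeight_rateWeight_of_ineq260 h260 hαδ hL hγ hRM) (Real.rpow_nonneg (zero_le_one.trans hL) γ)
    hεS hA₀ hM₀ hNK hmK hN' hm' hfix hfix' hA hK' hDS hDK hap hq'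

/-! ## §5 Non-vacuity: the scalar model computes the sharp constant -/

section Toy

/-- The one-site geometry (all lengths `1`, distance `0`). [folklore] -/
@[reducible] def toyG : B6.Geometry where
  Site := Unit
  fin := inferInstance
  scale := fun _ => 0
  dist := fun _ _ => 0
  k := 0
  eta := 1
  L := 1
  R := 1
  M := 1
  Hyp21_22 := True
  Loc := Unit
  suppIn := fun _ _ => True
  supNorm := fun _ => 0
  l2Norm := fun _ => 0
  holder := fun _ _ => 0
  Cut := Unit
  cutIn := fun _ _ => True
  cutH := fun _ _ => 0
  cutSup := fun _ => 0

/-- The block norm `|·|` on `ℝ` over the one-site geometry (one block, no cutting cost: `κ = 1`). [folklore] -/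
@[reducible] noncomputable def toyB : BlockNorm toyG ℝ where
  loc _ f := |f|
  cut _ := LinearMap.id
  IsLoc _ _ := True
  κ := 1
  κ_nonneg := zero_le_one
  loc_nonneg _ f := abs_nonneg f
  loc_zero _ := abs_zero
  loc_add_le _ f f' := abs_add_le f f'
  loc_neg _ f := abs_neg f
  sum_cut f := by
    show ∑ _y : Unit, (LinearMap.id : ℝ →ₗ[ℝ] ℝ) f = f
    simp
  isLoc_cut _ _ := trivial
  loc_cut_le _ f := by simp

/-- (2.54) holds on the one-site geometry. [folklore] -/
theorem toy_tri : Triangle254 toyG := fun _ _ _ => by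
  show (0 : ℝ) ≤ 0 + 0
  simp

/-- Distances are non-negative on the one-site geometry. [folklore] -/
theorem toy_dist : ∀ a b : toyG.Site, 0 ≤ toyG.dist a b := fun _ _ => le_refl (0 : ℝ)

/-- The weighted row-sum norm of a constant kernel on one site is the constant. [folklore] -/
theorem toy_wrow (n : ℝ) : WRow toyG 0 (fun _ _ => n) n := fun _ => by
  show ∑ _y : Unit, n * Real.exp (0 * (0 : ℝ)) ≤ n
  simp

/-- Multiplication by `c` has the majorant `|c|`. [folklore] -/
theorem toy_hasMaj (c : ℝ) : HasMaj toyB toyB (c • LinearMap.id) (fun _ _ => |c|) := by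
  intro _ μ _ _
  show |(c • LinearMap.id : ℝ →ₗ[ℝ] ℝ) μ| ≤ |c| * |μ|
  simp [abs_mul]

/-- The defect of two multiplications (identity transports) has the majorant `|c′ − c|`. [folklore] -/
theorem toy_hasMaj_idef (c' c : ℝ) :
    HasMaj toyB toyB (idef LinearMap.id LinearMap.id (c' • LinearMap.id) (c • LinearMap.id)) (fun _ _ => |c' - c|) := by
  intro _ μ _ _
  show |(idef LinearMap.id LinearMap.id (c' • LinearMap.id) (c • LinearMap.id) : ℝ →ₗ[ℝ] ℝ) μ| ≤ |c' - c| * |μ|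
  simp only [idef_apply, LinearMap.smul_apply, LinearMap.id_apply, smul_eq_mul]
  rw [← sub_mul, abs_mul]

/-- A scalar fixed point `a = s + ka` as an operator identity. [folklore] -/
theorem toy_fix {s k a : ℝ} (h : a = s + k * a) :
    (a • LinearMap.id : ℝ →ₗ[ℝ] ℝ) = s • LinearMap.id + (k • LinearMap.id) ∘ₗ (a • LinearMap.id) := by
  apply LinearMap.ext
  intro x
  simp only [LinearMap.smul_apply, LinearMap.id_apply, LinearMap.add_apply, LinearMap.comp_apply, smul_eq_mul]
  linear_combination x * h

/-- **SCALAR MODEL.**  Coarse run `a = s + ka`, fine run `a′ = s′ + k′a′` with `|k′| < 1` (all operators = multiplication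
on `ℝ`, transports = identity): `idef_neumann_majorant_flat` returns `|a′ − a| ≤ (|s′ − s| + |k′ − k|·|a|)/(1 − |k′|)` —
the SHARP scalar bound (`a′ − a = ((s′ − s) + (k′ − k)a)/(1 − k′)`).  Non-vacuity of §3 with the right constant. [folklore] -/
example (s k a s' k' a' : ℝ) (ha : a = s + k * a) (ha' : a' = s' + k' * a') (hk' : |k'| < 1) :
    |a' - a| ≤ (|s' - s| + |k' - k| * |a|) * (1 - |k'|)⁻¹ := by
  have H := idef_neumann_majorant_flat (b₁ := toyB) (b₂ := toyB) (b₂' := toyB)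
    (τ₁ := LinearMap.id) (τ₂ := LinearMap.id) (K := k • LinearMap.id) (K' := k' • LinearMap.id)
    (S := s • LinearMap.id) (A := a • LinearMap.id) (S' := s' • LinearMap.id) (A' := a' • LinearMap.id)
    (N_K := fun _ _ => |k' - k|) (N' := fun _ _ => |k'|) (εS := |s' - s|) (mK := |k' - k|) (m' := |k'|)
    (A₀ := |a|) (M₀ := |a' - a|) (ρ := 0)
    toy_tri toy_dist (le_refl 0) (abs_nonneg _) (abs_nonneg _) (abs_nonneg _)
    (fun _ _ => abs_nonneg _) (toy_wrow _) (fun _ _ => abs_nonneg _) (toy_wrow _) (toy_fix ha) (toy_fix ha')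
    ((toy_hasMaj a).mono fun _ _ => by simp) (toy_hasMaj k')
    ((toy_hasMaj_idef s' s).mono fun _ _ => by simp) (toy_hasMaj_idef k' k) (toy_hasMaj_idef a' a)
    (by show (1 : ℝ) * |k'| < 1; simpa using hk')
  have H1 : |a' * 1 - a * 1| ≤
      ((|s' - s| + 1 * |k' - k| * |a|) * (1 - 1 * |k'|)⁻¹ * Real.exp (-(0 * (0 : ℝ)))) * |(1 : ℝ)| :=
    H () (1 : ℝ) trivial ()
  simpa using H1

end Toy

end Literature.MathematicalPhysics.QuantumFieldTheory.Balaban1983to89.T4EtaRateDefect
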